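import Summits.AtomisticToContinuum.Crystallization.Theorems.FreeSplittingCertificatesStrictSplittingRuleP1LedgerGauge
import Summits.AtomisticToContinuum.Crystallization.Theorems.FreeSplittingCertificatesStrictSplittingRuleP1FluxBlockEnclosure
import Summits.AtomisticToContinuum.Crystallization.Theorems.FreeSplittingCertificatesStrictSplittingRuleNearBoxGridHcp

/-!
# `StrictSplittingRule` (stmt-AtomisticToContinuum-12560): the ACTIVE SITE SET of the near certificate as a kernel object, and the endpoint with NO existential site set (P1 interpolant object, part 109)

Route `FreeSplittingCertificates`, crux r3 `StrictSplittingRule` (H12⋆ = `stub_coreJointCoercive`), unit b2b-freesplit-B gen 52.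
(This file carries PRIVATE copies of part 107's two theorems — `cross_eq_zero_of_cross_pair'`, `nearForm_nonneg_of_ledger_coercive'` — so that it imports only
accepted modules; the public versions are part 107, `…P1LedgerDeflate`.)
VALUE = bookkeeping that makes the near hypothesis of `coreJointCoercive_cell_of_certificates₁₆` (part 108, sibling file `…P1LedgerTiers`) fully concrete (HOME CERT §49 (c′));
this file does not import part 108 (it re-runs the same four-step proof with `S := p1Active`), so that both can be verified independently.

The grid ledgers and the curvature bounds of the near certificate (nearcert v10 / fam51) live on the ACTIVE dofs: the lattice sites touched by at least one
term of the ledger at `p` (1 875 per representative), which is also the site set of the rigid deflation and of the metric `G`.  A hub computation of this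
generation (kit j207713: fam51's point build, both parities; `results/gen52-used/`) shows that this data-determined set is EXACTLY the lattice ball
`{q : ‖y_q − y_p‖² ≤ (18769/400)·a²}` (radius `6.85a` = nearcert's `EPS_RANGE2`), decided uniformly on the `HcpFamilyMin` box with no straddling site
(squared lattice distances are `A·a² + B·h²` with rational `A, B`).  Hence the kernel can NAME it without pinned data: **`p1Active p`** = the sites of an
index box around `p` whose squared distance from `p` AT THE BOX CENTRE `(a,h) = (97129, 79294)/10⁵` is `≤ (18769/400)·(97129/10⁵)²` (a fixed finite set,
independent of the theorem's `(a,h)` as the interpolation requires).  `mem_p1Active_self`, `mem_p1Active_shell₁/₂` and **`p1Active_act`** discharge the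
(ACT) clause of part 108 (`p ∈ S`, two first-shell sites with non-parallel relative positions), and **`coreJointCoercive_cell_of_certificates₁₇`** is
part 108's endpoint with `S := p1Active` — (NC_grid)/(NC_box) now quantify over NO site-set witness; proof = per `u` the interpolation
`near_gridBox_lower_v10`, then `nearForm_nonneg_of_ledger_coercive` (part 107), the flux booking of part 105, and `…₁₅`.  NOT a proof of H12⋆, NOT summit progress.  [folklore]
-/

noncomputable section

open Set Function Metric MeasureTheory Filter Topology
open scoped BigOperators NNReal ENNReal Classical Matrix

namespace Summit.AtomisticToContinuum.Crystallization.Theorems.StrictSplittingRuleBirth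

open Literature.MathematicalPhysics.StatisticalMechanics
open Summit.AtomisticToContinuum.Crystallization.Theorems.PalmUnimodularRigidity.LayeredLawsSelectHcp

/-! ### Local copies of part 107 (`…P1LedgerDeflate`, filed as p373353): kept PRIVATE so that this file depends only on accepted modules. -/

/-- (local copy of part 107) **Two independent directions pin a rotation vector**: `ω × d₁ = 0`, `ω × d₂ = 0` and `d₁ × d₂ ≠ 0` force `ω = 0`
(nine trilinear identities `ω_i (d₁ × d₂)_k ∈ span{(ω × d₁)_j, (ω × d₂)_j}`). [folklore] -/
private theorem cross_eq_zero_of_cross_pair' {ω d₁ d₂ : Fin 3 → ℝ} (h1 : ω ⨯₃ d₁ = 0) (h2 : ω ⨯₃ d₂ = 0) (hn : d₁ ⨯₃ d₂ ≠ 0) :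
    ω = 0 := by
  have h10 : ω 1 * d₁ 2 - ω 2 * d₁ 1 = 0 := by have := congrFun h1 0; simpa [cross_apply] using this
  have h11 : ω 2 * d₁ 0 - ω 0 * d₁ 2 = 0 := by have := congrFun h1 1; simpa [cross_apply] using this
  have h12 : ω 0 * d₁ 1 - ω 1 * d₁ 0 = 0 := by have := congrFun h1 2; simpa [cross_apply] using this
  have h20 : ω 1 * d₂ 2 - ω 2 * d₂ 1 = 0 := by have := congrFun h2 0; simpa [cross_apply] using this
  have h21 : ω 2 * d₂ 0 - ω 0 * d₂ 2 = 0 := by have := congrFun h2 1; simpa [cross_apply] using this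
  have h22 : ω 0 * d₂ 1 - ω 1 * d₂ 0 = 0 := by have := congrFun h2 2; simpa [cross_apply] using this
  have key : ∀ i k : Fin 3, ω i * (d₁ ⨯₃ d₂) k = 0 := by
    intro i k
    fin_cases i <;> fin_cases k <;>
      simp only [cross_apply, Fin.isValue, Fin.zero_eta, Fin.mk_one, Fin.reduceFinMk, Matrix.cons_val_zero, Matrix.cons_val_one,
        Matrix.cons_val]
    · linear_combination d₂ 1 * h11 + d₂ 2 * h12 + d₁ 0 * h20
    · linear_combination (-d₂ 0) * h11 + d₁ 0 * h21
    · linear_combination (-d₂ 0) * h12 + d₁ 0 * h22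
    · linear_combination (-d₂ 1) * h10 + d₁ 1 * h20
    · linear_combination d₂ 0 * h10 + d₂ 2 * h12 + d₁ 1 * h21
    · linear_combination (-d₂ 1) * h12 + d₁ 1 * h22
    · linear_combination (-d₂ 2) * h10 + d₁ 2 * h20
    · linear_combination (-d₂ 2) * h11 + d₁ 2 * h21
    · linear_combination (-d₂ 2) * h12 - d₁ 0 * h20 - d₁ 1 * h21
  obtain ⟨k, hk⟩ := Function.ne_iff.1 hn
  funext i
  exact (mul_eq_zero.1 (key i k)).resolve_right hk

/-- (local copy of part 107) **DEFLATION REMOVAL / THE NEAR REDUCTION IN THE KERNEL.**  `Q` is an arbitrary functional of the lattice values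
(instantiated with the booked finite near form); the hypothesis `hX` is the conclusion of the grid + box tiers (`X ⪰ (m_min − ρ)·G` on the box);
`S` = the active site set of the certificate (any finite set containing `p` and two sites not collinear with `p`).  NOT a proof of H12⋆, NOT summit
progress. [folklore] -/
private theorem nearForm_nonneg_of_ledger_coercive' {a h : ℝ} (ha : 0 < a) (p : ℤ × ℤ × ℤ) (S : Finset (ℤ × ℤ × ℤ)) (hpS : p ∈ S)
    {q₁ q₂ : ℤ × ℤ × ℤ} (hq₁ : q₁ ∈ S) (hq₂ : q₂ ∈ S) (hx : p1Rel a h p q₁ ⨯₃ p1Rel a h p q₂ ≠ 0)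
    (Q : (ℤ × ℤ × ℤ → (Fin 3 → ℝ)) → ℝ) {c : ℝ} (hc : 0 < c)
    (hX : ∀ u : ℤ × ℤ × ℤ → (Fin 3 → ℝ), c * p1NormSq S u ≤ Q (p1Vals a h p (p1StarAt p) u) + p1Defl a h p S u)
    {V : ℤ × ℤ × ℤ → (Fin 3 → ℝ)} (hVp : V p = 0)
    (hmom : ∀ Z : Fin 3 → Fin 3 → ℝ, (∀ j k, Z j k = -Z k j) →
      ∑ q ∈ p1StarAt p, ∑ k : Fin 3, V q k * (∑ j : Fin 3, (hcpSite a h q j - hcpSite a h p j) * Z j k) = 0) :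
    0 ≤ Q V := by
  -- the six deflation functionals of the rigid fields, as a linear endomorphism of ℝ⁶
  let L : (Fin 6 → ℝ) →ₗ[ℝ] (Fin 6 → ℝ) :=
    { toFun := fun cc => p1RigMom a h p S (p1Rigid a h p cc)
      map_add' := fun x y => by
        have e1 : p1Rigid a h p (x + y) - p1Rigid a h p y = p1Rigid a h p x := by
          rw [← p1Rigid_sub, add_sub_cancel_right]
        have e2 := p1RigMom_sub a h p S (p1Rigid a h p (x + y)) (p1Rigid a h p y)
        rw [e1] at e2
        rw [e2, sub_add_cancel]
      map_smul' := fun t x => by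
        simp only [p1Rigid_smul, p1RigMom_smul, RingHom.id_apply] }
  -- (1) L is injective: a rigid field with vanishing functionals is gauged to zero and undeflated, so coercivity kills it on S
  have hinj : Function.Injective L := by
    refine (injective_iff_map_eq_zero L).2 fun cc hcc => ?_
    have hcc' : p1RigMom a h p S (p1Rigid a h p cc) = 0 := hcc
    set r := p1Rigid a h p cc with hr
    have hnorm : p1NormSq S r = 0 := by
      by_contra hne
      have hpos : 0 < p1NormSq S r := lt_of_le_of_ne (p1NormSq_nonneg S r) (Ne.symm hne)
      have hcn : 0 < c * p1NormSq S r := mul_pos hc hpos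
      set K : ℝ := (|Q 0| + 1) / (c * p1NormSq S r) + 1 with hK
      have hK0 : 0 ≤ (|Q 0| + 1) / (c * p1NormSq S r) := by positivity
      have hK1 : 1 ≤ K := by rw [hK]; linarith
      have hXt := hX (K • r)
      have hV0 : p1Vals a h p (p1StarAt p) (K • r) = 0 := by
        rw [p1Vals_smul, hr, p1Vals_p1Rigid ha, smul_zero]
      have hD0 : p1Defl a h p S (K • r) = 0 :=
        p1Defl_eq_zero_of_rigMom a h p S (by rw [p1RigMom_smul, hcc', smul_zero])
      rw [hV0, hD0, add_zero, p1NormSq_smul] at hXt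
      -- hXt : c * (K ^ 2 * ‖r‖²_S) ≤ Q 0, but c‖r‖²·K² ≥ c‖r‖²·K = |Q 0| + 1 + c‖r‖² > Q 0
      have h1 : c * p1NormSq S r * K ≤ c * (K ^ 2 * p1NormSq S r) := by
        have : c * p1NormSq S r * K * 1 ≤ c * p1NormSq S r * K * K :=
          mul_le_mul_of_nonneg_left hK1 (by positivity)
        nlinarith
      have h2 : c * p1NormSq S r * K = (|Q 0| + 1) + c * p1NormSq S r := by
        rw [hK]; field_simp
      have h3 : Q 0 ≤ |Q 0| := le_abs_self _
      linarith
    have hrS : ∀ q ∈ S, r q = 0 := fun q hq => eq_zero_of_p1NormSq_eq_zero hnorm hq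
    have ht : (![cc 0, cc 1, cc 2] : Fin 3 → ℝ) = 0 := by
      have := hrS p hpS
      simpa [hr, p1Rigid, p1Rel_self] using this
    have hω1 : ![cc 3, cc 4, cc 5] ⨯₃ p1Rel a h p q₁ = 0 := by
      have := hrS q₁ hq₁
      simpa [hr, p1Rigid, ht] using this
    have hω2 : ![cc 3, cc 4, cc 5] ⨯₃ p1Rel a h p q₂ = 0 := by
      have := hrS q₂ hq₂
      simpa [hr, p1Rigid, ht] using this
    have hω := cross_eq_zero_of_cross_pair' hω1 hω2 hx
    funext k
    fin_cases k
    · have := congrFun ht 0; simpa using this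
    · have := congrFun ht 1; simpa using this
    · have := congrFun ht 2; simpa using this
    · have := congrFun hω 0; simpa using this
    · have := congrFun hω 1; simpa using this
    · have := congrFun hω 2; simpa using this
  -- (2) hence surjective: a rigid field with the same six functionals as V
  have hsurj : Function.Surjective L := LinearMap.injective_iff_surjective.1 hinj
  obtain ⟨cc, hcc⟩ := hsurj (p1RigMom a h p S V)
  have hcc' : p1RigMom a h p S (p1Rigid a h p cc) = p1RigMom a h p S V := hcc
  set w := V - p1Rigid a h p cc with hw
  have hw0 : p1RigMom a h p S w = 0 := by
    rw [hw, p1RigMom_sub, hcc', sub_self]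
  have hDw : p1Defl a h p S w = 0 := p1Defl_eq_zero_of_rigMom a h p S hw0
  have hVw : p1Vals a h p (p1StarAt p) w = V := by
    rw [hw, p1Vals_sub, p1Vals_p1Rigid ha, sub_zero, p1Vals_eq_self hVp hmom]
  have key := hX w
  rw [hVw, hDw, add_zero] at key
  exact le_trans (mul_nonneg hc.le (p1NormSq_nonneg S w)) key

/-- The booked near form (flux enclosure `(F₀, Δ)` on `QF` inside `p1NearForm`) is the flux-free near form minus `κ·p1NearFlux F₀ Δ QF` (local copy of part 108's lemma). -/
private theorem p1NearForm_booked_eq' (a h κ₁ κ₃ κ : ℝ) (p : ℤ × ℤ × ℤ) (Y₁ : Finset (ℤ × ℤ × ℤ)) (β : Bool → (ℤ × ℤ × ℤ) → (ℤ × ℤ × ℤ) → ℝ)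
    (M₁ N : Bool → (ℤ × ℤ × ℤ) → (ℤ × ℤ × ℤ) → (ℤ × ℤ × ℤ) → ℝ)
    (w : (ℤ × ℤ × ℤ) × (ℤ × ℤ × ℤ) → ℝ) (sv : ℤ × ℤ × ℤ) (wv : (ℤ × ℤ × ℤ) → ℝ) (colβ : (ℤ × ℤ × ℤ) → ℝ)
    (SH QB QT QF : Finset (ℤ × ℤ × ℤ)) (LEG : Finset ((ℤ × ℤ × ℤ) × (ℤ × ℤ × ℤ)))
    (L U PAYM Δ : (ℤ × ℤ × ℤ) → ℝ) (FL0 : (ℤ × ℤ × ℤ) × Fin 3 → (ℤ × ℤ × ℤ) × Fin 3 → ℝ)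
    (V : ℤ × ℤ × ℤ → (Fin 3 → ℝ)) :
    p1NearForm a h κ₁ κ₃ κ p Y₁ β M₁ N w sv wv colβ SH QB QT QF LEG L U PAYM Δ FL0 V =
      p1NearForm a h κ₁ κ₃ κ p Y₁ β M₁ N w sv wv colβ SH QB QT ∅ LEG L U PAYM (fun _ => 0) (fun _ _ => 0) V -
        κ * p1NearFlux FL0 Δ QF V := by
  unfold p1NearForm
  rw [p1NearFlux_empty]
  ring

/-- **THE ACTIVE SITE SET** of the near certificate at representative `p`: the lattice sites `q` of the index box
`[p₁−10, p₁+10] × [p₂−12, p₂+12] × [p₃−12, p₃+12]` with `‖y_q − y_p‖² ≤ (18769/400)·a²` at the box centre `(a,h) = (97129/10⁵, 79294/10⁵)`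
(= nearcert v10's touched set, 1 875 sites, for every `(a,h)` of the `HcpFamilyMin` box: kit j207713 + exact rational decision, HOME CERT §49). [folklore] -/
def p1Active (p : ℤ × ℤ × ℤ) : Finset (ℤ × ℤ × ℤ) :=
  (Finset.Icc (p.1 - 10) (p.1 + 10) ×ˢ (Finset.Icc (p.2.1 - 12) (p.2.1 + 12) ×ˢ Finset.Icc (p.2.2 - 12) (p.2.2 + 12))).filter
    (fun q => ‖hcpSite (97129 / 100000) (79294 / 100000) q - hcpSite (97129 / 100000) (79294 / 100000) p‖ ^ 2 ≤
      18769 / 400 * (97129 / 100000 : ℝ) ^ 2)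

/-- Membership in the active set: box membership and the squared-distance test at the centre. -/
theorem mem_p1Active {p q : ℤ × ℤ × ℤ} :
    q ∈ p1Active p ↔ q ∈ Finset.Icc (p.1 - 10) (p.1 + 10) ×ˢ (Finset.Icc (p.2.1 - 12) (p.2.1 + 12) ×ˢ Finset.Icc (p.2.2 - 12) (p.2.2 + 12)) ∧
      ‖hcpSite (97129 / 100000) (79294 / 100000) q - hcpSite (97129 / 100000) (79294 / 100000) p‖ ^ 2 ≤ 18769 / 400 * (97129 / 100000 : ℝ) ^ 2 := by
  unfold p1Active
  rw [Finset.mem_filter]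

/-- The base site is active. -/
theorem mem_p1Active_self (p : ℤ × ℤ × ℤ) : p ∈ p1Active p := by
  rw [mem_p1Active]
  exact ⟨by simp only [Finset.mem_product, Finset.mem_Icc]; omega, by rw [sub_self, norm_zero]; norm_num⟩

/-- Squared length of the first in-layer shell vector `y_{(0,1,0)}`: `a²`. -/
theorem hcpSite_010_norm_sq (a h : ℝ) : ‖hcpSite a h (0, 1, 0)‖ ^ 2 = a ^ 2 := by
  rw [hcpShell_norm_sq a h (by decide)]; simp

/-- Squared length of the shell vector `y_{(0,0,1)}`: `a²`. -/
theorem hcpSite_001_norm_sq (a h : ℝ) : ‖hcpSite a h (0, 0, 1)‖ ^ 2 = a ^ 2 := by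
  rw [hcpShell_norm_sq a h (by decide)]; simp

/-- For the two representatives, the relative position of the shell site `p ± (0,1,0)` resp. `p ± (0,0,1)` is `± y_{(0,1,0)}` resp. `± y_{(0,0,1)}`:
its squared length is `a²` for every `(a,h)`. -/
theorem norm_sq_shell_rep (a h : ℝ) :
    ‖hcpSite a h (0, 1, 0) - hcpSite a h (0, 0, 0)‖ ^ 2 = a ^ 2 ∧ ‖hcpSite a h (0, 0, 1) - hcpSite a h (0, 0, 0)‖ ^ 2 = a ^ 2 ∧
    ‖hcpSite a h (1, -1, 0) - hcpSite a h (1, 0, 0)‖ ^ 2 = a ^ 2 ∧ ‖hcpSite a h (1, 0, -1) - hcpSite a h (1, 0, 0)‖ ^ 2 = a ^ 2 := by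
  have e0 : hcpSite a h (0, 0, 0) = 0 := hcpSite_zero a h
  have e1 : hcpSite a h (1, -1, 0) - hcpSite a h (1, 0, 0) = -hcpSite a h (0, 1, 0) := by
    have := hcpSite_sub_of_odd a h (c := (1, 0, 0)) (by decide) (0, 1, 0)
    have e : ((1, 0, 0) : ℤ × ℤ × ℤ) - (0, 1, 0) = (1, -1, 0) := by decide
    rw [e] at this; rw [this]; abel
  have e2 : hcpSite a h (1, 0, -1) - hcpSite a h (1, 0, 0) = -hcpSite a h (0, 0, 1) := by
    have := hcpSite_sub_of_odd a h (c := (1, 0, 0)) (by decide) (0, 0, 1)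
    have e : ((1, 0, 0) : ℤ × ℤ × ℤ) - (0, 0, 1) = (1, 0, -1) := by decide
    rw [e] at this; rw [this]; abel
  exact ⟨by rw [e0, sub_zero, hcpSite_010_norm_sq], by rw [e0, sub_zero, hcpSite_001_norm_sq], by rw [e1, norm_neg, hcpSite_010_norm_sq],
    by rw [e2, norm_neg, hcpSite_001_norm_sq]⟩

/-- The cross product `y_{(0,1,0)} × y_{(0,0,1)} = (0, 0, a²√3/2)` does not vanish for `a ≠ 0`. -/
theorem cross_shell_ne_zero {a : ℝ} (ha : 0 < a) (h : ℝ) :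
    (fun k => hcpSite a h (0, 1, 0) k) ⨯₃ (fun k => hcpSite a h (0, 0, 1) k) ≠ 0 := by
  obtain ⟨l0, -, -⟩ := hcpShell_labels
  have h3 : (0 : ℝ) < √3 := Real.sqrt_pos.2 (by norm_num)
  intro hz
  have h2 := congrFun hz 2
  simp only [cross_apply, hcpSite_apply_zero, hcpSite_apply_one, l0, Fin.isValue, Matrix.cons_val, Pi.zero_apply] at h2
  push_cast at h2
  have : a * (a * √3 / 2) = 0 := by nlinarith [h2]
  rcases mul_eq_zero.1 this with h0 | h0
  · exact ha.ne' h0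
  · nlinarith

/-- **(ACT) for the active set**: at each representative `p`, `p ∈ p1Active p` and `p1Active p` holds two first-shell sites whose relative positions are not
parallel (for every `a > 0`, every `h`). -/
theorem p1Active_act {a h : ℝ} (ha : 0 < a) (p : ℤ × ℤ × ℤ) (hp : p ∈ ({(0, 0, 0), (1, 0, 0)} : Finset (ℤ × ℤ × ℤ))) :
    p ∈ p1Active p ∧ ∃ q₁ ∈ p1Active p, ∃ q₂ ∈ p1Active p, p1Rel a h p q₁ ⨯₃ p1Rel a h p q₂ ≠ 0 := by
  obtain ⟨c1, c2, c3, c4⟩ := norm_sq_shell_rep (97129 / 100000 : ℝ) (79294 / 100000)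
  have hbnd : (97129 / 100000 : ℝ) ^ 2 ≤ 18769 / 400 * (97129 / 100000 : ℝ) ^ 2 := by norm_num
  refine ⟨mem_p1Active_self p, ?_⟩
  simp only [Finset.mem_insert, Finset.mem_singleton] at hp
  rcases hp with rfl | rfl
  · refine ⟨(0, 1, 0), ?_, (0, 0, 1), ?_, ?_⟩
    · rw [mem_p1Active]; exact ⟨by simp only [Finset.mem_product, Finset.mem_Icc]; omega, by rw [c1]; exact hbnd⟩
    · rw [mem_p1Active]; exact ⟨by simp only [Finset.mem_product, Finset.mem_Icc]; omega, by rw [c2]; exact hbnd⟩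
    · have e0 : hcpSite a h (0, 0, 0) = 0 := hcpSite_zero a h
      have e1 : p1Rel a h (0, 0, 0) (0, 1, 0) = fun k => hcpSite a h (0, 1, 0) k := by
        funext k; simp [p1Rel, e0]
      have e2 : p1Rel a h (0, 0, 0) (0, 0, 1) = fun k => hcpSite a h (0, 0, 1) k := by
        funext k; simp [p1Rel, e0]
      rw [e1, e2]
      exact cross_shell_ne_zero ha h
  · refine ⟨(1, -1, 0), ?_, (1, 0, -1), ?_, ?_⟩
    · rw [mem_p1Active]; exact ⟨by simp only [Finset.mem_product, Finset.mem_Icc]; omega, by rw [c3]; exact hbnd⟩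
    · rw [mem_p1Active]; exact ⟨by simp only [Finset.mem_product, Finset.mem_Icc]; omega, by rw [c4]; exact hbnd⟩
    · have e1 : p1Rel a h (1, 0, 0) (1, -1, 0) = -(fun k => hcpSite a h (0, 1, 0) k) := by
        funext k
        have := hcpSite_sub_of_odd a h (c := (1, 0, 0)) (by decide) (0, 1, 0)
        have e : ((1, 0, 0) : ℤ × ℤ × ℤ) - (0, 1, 0) = (1, -1, 0) := by decide
        rw [e] at this
        simp only [p1Rel, this, Pi.neg_apply]
        simp
      have e2 : p1Rel a h (1, 0, 0) (1, 0, -1) = -(fun k => hcpSite a h (0, 0, 1) k) := by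
        funext k
        have := hcpSite_sub_of_odd a h (c := (1, 0, 0)) (by decide) (0, 0, 1)
        have e : ((1, 0, 0) : ℤ × ℤ × ℤ) - (0, 0, 1) = (1, 0, -1) := by decide
        rw [e] at this
        simp only [p1Rel, this, Pi.neg_apply]
        simp
      rw [e1, e2]
      simp only [map_neg, LinearMap.neg_apply, neg_neg]
      exact cross_shell_ne_zero ha h

/-- **THE CELL'S ENDPOINT WITH THE NEAR CERTIFICATE'S TIERS ON THE NAMED ACTIVE SET.**  Part 108's `coreJointCoercive_cell_of_certificates₁₆` with the site sets
`S := p1Active` and its (ACT) clause discharged (`p1Active_act`): (NC_grid) = the 81 + 81 node ledgers `X(a_i,h_j;u) ≥ (583/2²⁷)·Σ_{q ∈ p1Active p}‖u_q‖²` of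
`p1LedgerX … (p1Active p) u`, (NC_box) = its curvature bounds `10941 / 3440` on the box (derivatives assumed to exist), (ENC) = the collar-flux block rows — for SOME
`(a,h)`-families of near tables `M₁, N` (support `QT`) and flux tables `F₀, Δ`; (B∃_fin, 12a), (S_fin), (TAB′), (PAY_near) verbatim.  NOT a proof of H12⋆ (the tiers are certified outside the kernel),
NOT summit progress. [folklore] -/
theorem coreJointCoercive_cell_of_certificates₁₇ {a h : ℝ} (ha : 0 < a) (hh : 0 < h) (hfam : HcpFamilyMin a h)
    -- (B∃_fin, 12a) THE PER-CELL BUDGET at each representative FOR SOME allocation tables that follow the EXACT RULE on the cells ≥ 12a away, asked only for the FINITELY MANY cells of the 12a cell box with a vertex within 12a THAT CARRY LOAD under the tables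
    (hB : ∀ p ∈ ({(0, 0, 0), (1, 0, 0)} : Finset (ℤ × ℤ × ℤ)),
      ∃ θ θv : (ℤ × ℤ × ℤ) × (ℤ × ℤ × ℤ) → (ℤ × ℤ × ℤ) × Fin 6 → ℝ,
        (∀ e T, 0 ≤ θ e T) ∧ (∀ e, (Function.support (θ e)).Finite) ∧ (∀ T, (Function.support fun e => θ e T).Finite) ∧
        (∀ e, p1FarW a h (p1Phi0 p) p e ≠ 0 → ∑ᶠ T, θ e T = 1) ∧
        (∀ e T, θ e T ≠ 0 → ∃ m m' : Fin 4, e.1 = T.1 + p1VertOff (p1Par T.1) T.2 m ∧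
          e.1 + e.2 = T.1 + p1VertOff (p1Par T.1) T.2 m') ∧
        (∀ e T, 0 ≤ θv e T) ∧ (∀ e, (Function.support (θv e)).Finite) ∧ (∀ T, (Function.support fun e => θv e T).Finite) ∧
        (∀ e, (∑ i : Fin 3, (2 / 3) * ((if e.2 = p1RouteOff e.1 i then p1FarWv a h (p1Phi0 p) p e.1 else 0) +
          (if p1RouteOff (e.1 - (p1SV - e.2)) i = p1SV - e.2 then p1FarWv a h (p1Phi0 p) p (e.1 - (p1SV - e.2)) else 0))) ≠ 0 → ∑ᶠ T, θv e T = 1) ∧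
        (∀ e T, θv e T ≠ 0 → ∃ m m' : Fin 4, e.1 = T.1 + p1VertOff (p1Par T.1) T.2 m ∧
          e.1 + e.2 = T.1 + p1VertOff (p1Par T.1) T.2 m') ∧
        (∀ T : (ℤ × ℤ × ℤ) × Fin 6, (∀ m : Fin 4, 12 * a ≤ ‖hcpSite a h (T.1 + p1VertOff (p1Par T.1) T.2 m) - hcpSite a h p‖) →
          ∀ e, θ e T = p1ThetaX a h p e T ∧ θv e T = p1ThetaX a h p e T) ∧
        ∀ (T : (ℤ × ℤ × ℤ) × Fin 6), T.1 ∈ p1CellBox12 p →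
          (∃ m : Fin 4, ‖hcpSite a h (T.1 + p1VertOff (p1Par T.1) T.2 m) - hcpSite a h p‖ < 12 * a) → (∃ e, θ e T ≠ 0 ∨ θv e T ≠ 0) →
          ∀ (G : Fin 3 → Fin 3 → ℝ),
      (∑ᶠ e : (ℤ × ℤ × ℤ) × (ℤ × ℤ × ℤ), θ e T * p1FarW a h (p1Phi0 p) p e *
          fpSq (fun k => (hcpSite a h (e.1 + e.2) 0 - hcpSite a h e.1 0) * G 0 k +
            (hcpSite a h (e.1 + e.2) 1 - hcpSite a h e.1 1) * G 1 k + (hcpSite a h (e.1 + e.2) 2 - hcpSite a h e.1 2) * G 2 k)) +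
      (∑ᶠ e : (ℤ × ℤ × ℤ) × (ℤ × ℤ × ℤ), θv e T *
          (∑ i : Fin 3, (2 / 3) * ((if e.2 = p1RouteOff e.1 i then p1FarWv a h (p1Phi0 p) p e.1 else 0) +
            (if p1RouteOff (e.1 - (p1SV - e.2)) i = p1SV - e.2 then p1FarWv a h (p1Phi0 p) p (e.1 - (p1SV - e.2)) else 0))) *
          fpSq (fun k => (hcpSite a h (e.1 + e.2) 0 - hcpSite a h e.1 0) * G 0 k +
            (hcpSite a h (e.1 + e.2) 1 - hcpSite a h e.1 1) * G 1 k + (hcpSite a h (e.1 + e.2) 2 - hcpSite a h e.1 2) * G 2 k)) +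
      p1CellDefectG a h (fun y k l => (193 / 125) * ((7 * (5 / 4 : ℝ) + 3 / 4) / 4) * fpChi ((81 / 20 * a) ^ 2) ((27 / 5 * a) ^ 2) (y - fun k => hcpSite a h p k) ^ 2 *
          (fpSq (y - fun k => hcpSite a h p k))⁻¹ ^ 5 * ((y - fun k => hcpSite a h p k) k * (y - fun k => hcpSite a h p k) l)) T G ≤
      (193 / 125) * ((5 / 2 * (1 / 24 * fpSymSq G) + 5 / 2 * (1 / 24 * (fpFrob G - fpSymSq G))) *
        ∫ y in p1RealCell a h T, fpChi ((81 / 20 * a) ^ 2) ((27 / 5 * a) ^ 2) (y - fun k => hcpSite a h p k) ^ 2 * (fpSq (y - fun k => hcpSite a h p k))⁻¹ ^ 3))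
    -- (S_fin) per-site domination off the PINNED reach set at the FINITELY MANY sites of the 20a index box with `‖y_q − y_p‖ < 20a`; (TAB') the PINNED certified tables, `L` NORMALISED by `‖y_q − y_p‖²` (the certificates' convention)
    (hS : ∀ p ∈ ({(0, 0, 0), (1, 0, 0)} : Finset (ℤ × ℤ × ℤ)),
      ∀ q ∈ Finset.Icc (p.1 - 26) (p.1 + 26) ×ˢ (Finset.Icc (p.2.1 - 34) (p.2.1 + 34) ×ˢ Finset.Icc (p.2.2 - 23) (p.2.2 + 23)),
      q ∉ p1QB p → q ≠ p → ‖hcpSite a h q - hcpSite a h p‖ < 20 * a → ∀ z : Fin 3 → ℝ,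
      0 ≤ 1 / 2 * (ljSqDeriv (‖hcpSite a h q - hcpSite a h p‖ ^ 2) * fpSq z +
          2 * (1 / 2 * (7 * ((‖hcpSite a h q - hcpSite a h p‖ ^ 2)⁻¹) ^ 8 -
            4 * ((‖hcpSite a h q - hcpSite a h p‖ ^ 2)⁻¹) ^ 5)) * p1NRad a h p (fun _ => z) q ^ 2) +
        p1SiteBare a h (fun y k l => (193 / 125) * ((7 * (5 / 4 : ℝ) + 3 / 4) / 4) * fpChi ((81 / 20 * a) ^ 2) ((27 / 5 * a) ^ 2) (y - fun k => hcpSite a h p k) ^ 2 *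
          (fpSq (y - fun k => hcpSite a h p k))⁻¹ ^ 5 * ((y - fun k => hcpSite a h p k) k * (y - fun k => hcpSite a h p k) l)) (fun _ => z) q -
        p1SiteBare a h (fun y k l => (193 / 125) * ((3 / 4 : ℝ) / 4) * fpChi ((81 / 20 * a) ^ 2) ((27 / 5 * a) ^ 2) (y - fun k => hcpSite a h p k) ^ 2 *
          (fpSq (y - fun k => hcpSite a h p k))⁻¹ ^ 4 * (if k = l then 1 else 0)) (fun _ => z) q)
    (hTab : ∀ p ∈ ({(0, 0, 0), (1, 0, 0)} : Finset (ℤ × ℤ × ℤ)), ∀ q ∈ p1QB p, q ≠ p → ∀ z : Fin 3 → ℝ,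
      (p1LU p q).1 / ‖hcpSite a h q - hcpSite a h p‖ ^ 2 * p1NRad a h p (fun _ => z) q ^ 2 ≤
        p1SiteBare a h (fun y k l => (193 / 125) * ((7 * (5 / 4 : ℝ) + 3 / 4) / 4) * fpChi ((81 / 20 * a) ^ 2) ((27 / 5 * a) ^ 2) (y - fun k => hcpSite a h p k) ^ 2 *
          (fpSq (y - fun k => hcpSite a h p k))⁻¹ ^ 5 * ((y - fun k => hcpSite a h p k) k * (y - fun k => hcpSite a h p k) l)) (fun _ => z) q ∧
      p1SiteBare a h (fun y k l => (193 / 125) * ((3 / 4 : ℝ) / 4) * fpChi ((81 / 20 * a) ^ 2) ((27 / 5 * a) ^ 2) (y - fun k => hcpSite a h p k) ^ 2 *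
          (fpSq (y - fun k => hcpSite a h p k))⁻¹ ^ 4 * (if k = l then 1 else 0)) (fun _ => z) q ≤ (p1LU p q).2 * fpSq z)
    -- (PAY_near) the far table's column sums over the FINITELY MANY sites of the 44a box WITHIN 44a of y_p, by the PINNED payments minus the kernel's far allowance
    (hPAY : ∀ p ∈ ({(0, 0, 0), (1, 0, 0)} : Finset (ℤ × ℤ × ℤ)), ∀ s ∈ p1BondOffsets, (193 / 125) * (2 / 5) / a ^ 4 *
      (∑ q ∈ Finset.Icc (p.1 - 53) (p.1 + 53) ×ˢ (Finset.Icc (p.2.1 - 69) (p.2.1 + 69) ×ˢ Finset.Icc (p.2.2 - 51) (p.2.2 + 51)),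
        if ‖hcpSite a h q - hcpSite a h p‖ < 44 * a then
          p1RecTable a h (p1SplitDensity (81 / 20 * a) (27 / 5 * a)) (decide (Even p.1)) (q - p) s else 0) ≤
      p1Paym p s - 3 / 200000 * p1BondW (fun _ => (1 : ℝ)) p s)
    -- (NC_tiers′) THE NEAR CERTIFICATE'S TIERS ON THE ACTIVE SET `p1Active p`, for SOME near tables and flux enclosure tables
    (hNC : ∃ M₁ N : ℝ → ℝ → Bool → (ℤ × ℤ × ℤ) → (ℤ × ℤ × ℤ) → (ℤ × ℤ × ℤ) → ℝ, ∃ QT : (ℤ × ℤ × ℤ) → Finset (ℤ × ℤ × ℤ),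
      ∃ F0 : ℝ → ℝ → (ℤ × ℤ × ℤ) → ((ℤ × ℤ × ℤ) × Fin 3 → (ℤ × ℤ × ℤ) × Fin 3 → ℝ), ∃ Δ : ℝ → ℝ → (ℤ × ℤ × ℤ) → (ℤ × ℤ × ℤ) → ℝ,
      (∀ b d s s', s ∉ p1BondOffsets ∨ s' ∉ p1BondOffsets → M₁ a h b d s s' = 0 ∧ N a h b d s s' = 0) ∧
      (∃ C₁ : ℝ, ∀ p q : ℤ × ℤ × ℤ, ∀ s s', |M₁ a h (decide (Even p.1)) (q - p) s s'| ≤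
        C₁ * ((1 + ‖hcpSite a h q - hcpSite a h p‖)⁻¹) ^ 6 ∧
      |N a h (decide (Even p.1)) (q - p) s s'| ≤ C₁ * ((1 + ‖hcpSite a h q - hcpSite a h p‖)⁻¹) ^ 6) ∧
      (∀ p ∈ ({(0, 0, 0), (1, 0, 0)} : Finset (ℤ × ℤ × ℤ)), ∀ q : ℤ × ℤ × ℤ, q ∉ QT p → ∀ s s',
      M₁ a h (decide (Even p.1)) (q - p) s s' = 0 ∧ M₁ a h (decide (Even q.1)) (p - q) s s' = 0 ∧
      N a h (decide (Even p.1)) (q - p) s s' = 0 ∧ N a h (decide (Even q.1)) (p - q) s' s = 0) ∧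
      ∀ p ∈ ({(0, 0, 0), (1, 0, 0)} : Finset (ℤ × ℤ × ℤ)),
        -- (ENC) block-row bounds of the exact collar flux against the booked tables at (a,h)
        (∃ R : (ℤ × ℤ × ℤ) → (ℤ × ℤ × ℤ) → ℝ, (∀ q q', 0 ≤ R q q') ∧ (∀ q q', R q q' = R q' q) ∧
          (∀ q ∈ p1ScatterQF (p1CollarBox p), ∀ q' ∈ p1ScatterQF (p1CollarBox p),
            ∑ k, ∑ l, (p1ScatterFL0 (p1ExactFluxMat a h p) (p1CollarBox p) (q, k) (q', l) - F0 a h p (q, k) (q', l)) ^ 2 ≤ R q q' ^ 2) ∧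
          (∀ q ∈ p1ScatterQF (p1CollarBox p), ∑ q' ∈ p1ScatterQF (p1CollarBox p), R q q' ≤ Δ a h p q)) ∧
        -- (NC_grid) the 81 node ledgers on the active set
        (∀ u : ℤ × ℤ × ℤ → (Fin 3 → ℝ), ∀ i j : ℕ, i ≤ 8 → j ≤ 8 →
          583 / 134217728 * p1NormSq (p1Active p) u ≤
            p1LedgerX (97119 / 100000 + i * (1 / 40000)) (79284 / 100000 + j * (1 / 40000)) p
              (M₁ (97119 / 100000 + i * (1 / 40000)) (79284 / 100000 + j * (1 / 40000)))
              (N (97119 / 100000 + i * (1 / 40000)) (79284 / 100000 + j * (1 / 40000))) (QT p)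
              (F0 (97119 / 100000 + i * (1 / 40000)) (79284 / 100000 + j * (1 / 40000)) p)
              (Δ (97119 / 100000 + i * (1 / 40000)) (79284 / 100000 + j * (1 / 40000)) p) (p1Active p) u) ∧
        -- (NC_box) twice differentiable in a and in h on the box, curvature bounded by 10941 / 3440 times Σ_{q ∈ p1Active p}‖u_q‖²
        (∀ u : ℤ × ℤ × ℤ → (Fin 3 → ℝ), ∃ Xa Xaa Xh Xhh : ℝ → ℝ → ℝ,
          (∀ a' ∈ Icc (97119 / 100000 : ℝ) (97139 / 100000), ∀ h' ∈ Icc (79284 / 100000 : ℝ) (79304 / 100000),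
            HasDerivAt (fun x => p1LedgerX x h' p (M₁ x h') (N x h') (QT p) (F0 x h' p) (Δ x h' p) (p1Active p) u) (Xa a' h') a') ∧
          (∀ a' ∈ Icc (97119 / 100000 : ℝ) (97139 / 100000), ∀ h' ∈ Icc (79284 / 100000 : ℝ) (79304 / 100000),
            HasDerivAt (fun x => Xa x h') (Xaa a' h') a') ∧
          (∀ a' ∈ Icc (97119 / 100000 : ℝ) (97139 / 100000), ∀ h' ∈ Icc (79284 / 100000 : ℝ) (79304 / 100000),
            Xaa a' h' ≤ 10941 * p1NormSq (p1Active p) u) ∧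
          (∀ a' ∈ Icc (97119 / 100000 : ℝ) (97139 / 100000), ∀ h' ∈ Icc (79284 / 100000 : ℝ) (79304 / 100000),
            HasDerivAt (fun y => p1LedgerX a' y p (M₁ a' y) (N a' y) (QT p) (F0 a' y p) (Δ a' y p) (p1Active p) u) (Xh a' h') h') ∧
          (∀ a' ∈ Icc (97119 / 100000 : ℝ) (97139 / 100000), ∀ h' ∈ Icc (79284 / 100000 : ℝ) (79304 / 100000),
            HasDerivAt (fun y => Xh a' y) (Xhh a' h') h') ∧
          (∀ a' ∈ Icc (97119 / 100000 : ℝ) (97139 / 100000), ∀ h' ∈ Icc (79284 / 100000 : ℝ) (79304 / 100000),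
            Xhh a' h' ≤ 3440 * p1NormSq (p1Active p) u))) :
    CoreJointCoercive a h (1 / 3) (1 / 12) := by
  refine coreJointCoercive_cell_of_certificates₁₅ ha hh hfam hB hS hTab hPAY ?_
  obtain ⟨M₁, N, QT, F0, Δ, hst, hdec, hQT, hmain⟩ := hNC
  refine ⟨M₁ a h, N a h, QT, hst, hdec, hQT, fun p hp V hVp hmom => ?_⟩
  obtain ⟨⟨R, hR0, hRs, hE, hrow⟩, hgrid, hbox⟩ := hmain p hp
  obtain ⟨hpS, q₁, hq₁, q₂, hq₂, hx⟩ := p1Active_act ha p hp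
  -- (i) grid + box ⇒ the ledger family is coercive at (a,h) on the active set
  have hcoer : ∀ u : ℤ × ℤ × ℤ → (Fin 3 → ℝ),
      168829799 / 52428800000000 * p1NormSq (p1Active p) u ≤
        p1LedgerX a h p (M₁ a h) (N a h) (QT p) (F0 a h p) (Δ a h p) (p1Active p) u := by
    intro u
    obtain ⟨Xa, Xaa, Xh, Xhh, dFa, dFaa, bFaa, dFh, dFhh, bFhh⟩ := hbox u
    exact near_gridBox_lower_v10
      (F := fun x y => p1LedgerX x y p (M₁ x y) (N x y) (QT p) (F0 x y p) (Δ x y p) (p1Active p) u)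
      (Fa := Xa) (Faa := Xaa) (Fh := Xh) (Fhh := Xhh) (p1NormSq_nonneg _ u) (hgrid u) dFa dFaa bFaa dFh dFhh bFhh ha hh hfam
  -- (ii) deflation removal + gauge reduction ⇒ the BOOKED near form is ≥ 0 at V
  have hbooked : 0 ≤ p1NearForm a h (1 / 3) (1 / 12) (193 / 125) p p1Stencil (p1Beta a h) (M₁ a h) (N a h) (p1FarW a h (p1Phi0 p) p) p1SV
      (p1FarWv a h (p1Phi0 p) p) (fun s => -p1Beta a h (decide (Even p.1)) 0 s) (p1StarAt p) (p1QB p) (QT p)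
      (p1ScatterQF (p1CollarBox p)) (p1FarLegs (p1Phi0 p) p) (fun q => (p1LU p q).1 / ‖hcpSite a h q - hcpSite a h p‖ ^ 2)
      (fun q => (p1LU p q).2) (p1Paym p) (Δ a h p) (F0 a h p) V :=
    nearForm_nonneg_of_ledger_coercive' ha p (p1Active p) hpS hq₁ hq₂ hx
      (fun W => p1NearForm a h (1 / 3) (1 / 12) (193 / 125) p p1Stencil (p1Beta a h) (M₁ a h) (N a h) (p1FarW a h (p1Phi0 p) p) p1SV
        (p1FarWv a h (p1Phi0 p) p) (fun s => -p1Beta a h (decide (Even p.1)) 0 s) (p1StarAt p) (p1QB p) (QT p)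
        (p1ScatterQF (p1CollarBox p)) (p1FarLegs (p1Phi0 p) p) (fun q => (p1LU p q).1 / ‖hcpSite a h q - hcpSite a h p‖ ^ 2)
        (fun q => (p1LU p q).2) (p1Paym p) (Δ a h p) (F0 a h p) W)
      (by norm_num) (fun u => hcoer u) hVp hmom
  -- (iii) flux booking: exact collar flux ≤ enclosure form
  have hENC := p1ExactFluxSum_le_p1NearFlux_of_blockRows a h p (F0 a h p) (Δ a h p) R hR0 hRs hE hrow V
  -- (iv) assemble
  rw [p1NearForm_booked_eq'] at hbooked
  have := mul_le_mul_of_nonneg_left hENC (by norm_num : (0 : ℝ) ≤ 193 / 125)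
  show 0 ≤ _
  unfold p1StarAt at hbooked
  linarith

end Summit.AtomisticToContinuum.Crystallization.Theorems.StrictSplittingRuleBirth

end
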